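import Summits.BirchSwinnertonDyer.BirchSwinnertonDyer.Theses.ShadowIsolation
import Summits.BirchSwinnertonDyer.BirchSwinnertonDyer.Theses.SelmerRank
import Summits.BirchSwinnertonDyer.BirchSwinnertonDyer.Theses.Squeeze
import Summits.BirchSwinnertonDyer.BirchSwinnertonDyer.Theses.TangentCone
import Summits.BirchSwinnertonDyer.BirchSwinnertonDyer.Theorems.ShadowIsolationSelmerRankUBStubGzkSelmerCell
import Summits.BirchSwinnertonDyer.BirchSwinnertonDyer.Theorems.ShadowIsolationSelmerRankUBStubShaCotorsionBigImage
import Summits.BirchSwinnertonDyer.BirchSwinnertonDyer.Theorems.ShadowIsolationSelmerRankUBStubNoExcessRankBigImage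
import HarnessLib

/-!
# BirchSwinnertonDyer / ShadowIsolation — crux `SelmerRankUB` (stmt-BirchSwinnertonDyer-0130),
# line `greenberg-split`: the composition and the crux's net debt per route

The crux (route ShadowIsolation #4 = route SelmerRank #3 = route NormCapitulation #4, `rfl`-equal
decls): for `W/ℚ` globally minimal elliptic and `p ≥ 5` good ordinary with `ρ̄_{E,p}` surjective,
`corank_{ℤ_p} Sel_{p^∞}(E/ℚ) ≤ ord_{s=1} L(E,s)`.

Line `greenberg-split` (skeleton `Cruxes/SelmerRankUB/Lines/greenberg_split.lean`, registered on the
item) cuts the crux by Greenberg's PROVED identity `corank Sel_{p^∞} = rank + corank Ш[p^∞]`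
(`WeierstrassCurve.selmerCorank_eq_mordellWeilRank_add_holds`) into three registered stubs:

* `stub_gzkSelmerCell` — `r_an ≤ 1 ⇒ corank_p ≤ r_an` (Kato / Gross–Zagier–Kolyvagin; literature
  debt behind the named fact `rank_eq_analyticRank_of_analyticRank_le_one`, conditional discharge
  landed: `gzkSelmerCell_of_grossZagierKolyvagin`);
* `stub_noExcessRankBigImage` — `rank ≤ r_an` at a big-image good ordinary `p ≥ 5`, `r_an ≥ 2`
  (OPEN: the sibling crux `SqueezeUB` on non-CM curves; discharges landed:
  `noExcessRankBigImage_of_squeezeUB`, `noExcessRankBigImage_of_edgeDecay_of_edgeCap`);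
* `stub_shaCotorsionBigImage` — `corank Ш[p^∞] = 0` there (OPEN: Ш-cotorsion; in-route discharges
  landed: `shaCotorsionBigImage_of_isolation_of_shadow`, `shaCotorsionBigImage_of_shaPFinite`).

This file lands the sorry-free COMPOSITION `selmerRankUB_of_greenbergSplit` (the three stub
statements ⇒ the crux BY NAME: case `r_an ≤ 1` the GZK cell, else Greenberg's identity, the Ш-half
kills the second summand and the rank half bounds the first), its EXACTNESS
(`selmerRankUB_iff_noExcessRankBigImage`: modulo the GZK cell and the Ш-half the crux is EQUIVALENT
to the rank stub), and the crux's NET DEBT on each wanting route as theorems whose hypotheses are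
registered items only:

* `selmerRankUB_of_isolation_of_shadow_of_edge` — ShadowIsolation's own cruxes
  `IsolationOfAccidentalZeros`, `PhantomShadow` + TangentCone's `EdgeDecay`, `EdgeCap`, `RankLeOne`;
* `selmerRankUB_of_isolation_of_shadow_of_squeezeUB` — `IsolationOfAccidentalZeros`, `PhantomShadow`
  + `SqueezeUB` + `RankLeOne`;
* `selmerRankUBSelmerRank_of_shaPFinite_of_squeezeUB` — route SelmerRank: `SelmerRankShaPFinite`
  + `SqueezeUB` + `RankLeOne`.

So on either route the crux has no content of its own beyond the non-CM, `r_an ≥ 2` case of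
`SqueezeUB` (stmt-0496 / 0145) — or TangentCone's edge pair — plus the Gross–Zagier–Kolyvagin fact.
Sources: Greenberg, LNM 1716 (1999), §1; Darmon, CBMS 101 (2004), Thm. 3.22. No definition is
introduced; the stub statements are spelled out verbatim (they are registered on the item).
-/

-- D-0017: single-problem summit, so `Summit.BirchSwinnertonDyer.BirchSwinnertonDyer.…` repeats a
-- namespace BY DESIGN.
set_option linter.dupNamespace false

namespace Summit.BirchSwinnertonDyer.BirchSwinnertonDyer.Theorems

open Summit.BirchSwinnertonDyer.BirchSwinnertonDyer.Theses

/-- **The crux `SelmerRankUB` BY NAME from the three stub statements of line `greenberg-split`**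
(registered sub-goal `selmerRankUB_of_greenbergSplit` of stmt-BirchSwinnertonDyer-0130, arrow form:
`stub_gzkSelmerCell → stub_noExcessRankBigImage → stub_shaCotorsionBigImage → SelmerRankUB`): if
`r_an ≤ 1` the GZK-Selmer cell; else Greenberg's identity `corank Sel_{p^∞} = rank + corank Ш[p^∞]`
(`selmerCorank_eq_mordellWeilRank_add_holds`), the Ш-half kills the second summand and the rank
half bounds the first. [cite: GreenbergLNM1716, §1] -/
theorem selmerRankUB_of_greenbergSplit :
    (∀ (W : WeierstrassCurve ℚ) [W.IsElliptic] (p : ℕ) [Fact p.Prime],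
        W.analyticRank ≤ 1 → W.selmerCorank p ≤ W.analyticRank) →
    (∀ (W : WeierstrassCurve ℚ) [W.IsElliptic] [W.IsGloballyMinimal] (p : ℕ) [Fact p.Prime],
        5 ≤ p → W.HasGoodReductionAtPrime p → ¬ (p : ℤ) ∣ W.frobeniusTrace p →
          W.HasSurjectiveModNGaloisRep p → 2 ≤ W.analyticRank →
            W.mordellWeilRank ≤ W.analyticRank) →
    (∀ (W : WeierstrassCurve ℚ) [W.IsElliptic] [W.IsGloballyMinimal] (p : ℕ) [Fact p.Prime],
        5 ≤ p → W.HasGoodReductionAtPrime p → ¬ (p : ℤ) ∣ W.frobeniusTrace p →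
          W.HasSurjectiveModNGaloisRep p → 2 ≤ W.analyticRank → W.shaCorank p = 0) →
    Summit.BirchSwinnertonDyer.BirchSwinnertonDyer.Theses.ShadowIsolation.SelmerRankUB := by
  intro hGZK hRank hSha W _ _ p _ h5 hgood hord hsurj
  by_cases h1 : W.analyticRank ≤ 1
  · exact hGZK W p h1
  · have h2 : 2 ≤ W.analyticRank := by omega
    rw [W.selmerCorank_eq_mordellWeilRank_add_holds p, hSha W p h5 hgood hord hsurj h2, add_zero]
    exact hRank W p h5 hgood hord hsurj h2

/-- **Exactness of the split.** Granting the GZK-Selmer cell and the Ш-half, the crux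
`SelmerRankUB` is EQUIVALENT to the rank stub `stub_noExcessRankBigImage` (necessity is
`noExcessRankBigImage_of_selmerRankUB`: `rank ≤ rank + corank Ш = corank Sel ≤ r_an`). So the
line's entire residual is that stub — the non-CM, `r_an ≥ 2` case of `SqueezeUB`.
[cite: GreenbergLNM1716, §1] -/
theorem selmerRankUB_iff_noExcessRankBigImage
    (hGZK : ∀ (W : WeierstrassCurve ℚ) [W.IsElliptic] (p : ℕ) [Fact p.Prime],
        W.analyticRank ≤ 1 → W.selmerCorank p ≤ W.analyticRank)
    (hSha : ∀ (W : WeierstrassCurve ℚ) [W.IsElliptic] [W.IsGloballyMinimal] (p : ℕ) [Fact p.Prime],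
        5 ≤ p → W.HasGoodReductionAtPrime p → ¬ (p : ℤ) ∣ W.frobeniusTrace p →
          W.HasSurjectiveModNGaloisRep p → 2 ≤ W.analyticRank → W.shaCorank p = 0) :
    Summit.BirchSwinnertonDyer.BirchSwinnertonDyer.Theses.ShadowIsolation.SelmerRankUB ↔
      ∀ (W : WeierstrassCurve ℚ) [W.IsElliptic] [W.IsGloballyMinimal] (p : ℕ) [Fact p.Prime],
        5 ≤ p → W.HasGoodReductionAtPrime p → ¬ (p : ℤ) ∣ W.frobeniusTrace p →
          W.HasSurjectiveModNGaloisRep p → 2 ≤ W.analyticRank →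
            W.mordellWeilRank ≤ W.analyticRank :=
  ⟨fun hUB => noExcessRankBigImage_of_selmerRankUB hUB,
    fun hR => selmerRankUB_of_greenbergSplit hGZK hR hSha⟩

/-- The GZK-Selmer cell from route TangentCone's item `RankLeOne` (the same statement as the
named fact `rank_eq_analyticRank_of_analyticRank_le_one`, Gross–Zagier–Kolyvagin: `r_an ≤ 1 ⇒
rank = r_an ∧ Ш finite`), through the landed conditional discharge
`gzkSelmerCell_of_grossZagierKolyvagin`. [cite: Darmon2004, Thm. 3.22] -/
theorem gzkSelmerCell_of_rankLeOne (h : TangentCone.RankLeOne) :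
    ∀ (W : WeierstrassCurve ℚ) [W.IsElliptic] (p : ℕ) [Fact p.Prime],
      W.analyticRank ≤ 1 → W.selmerCorank p ≤ W.analyticRank :=
  gzkSelmerCell_of_grossZagierKolyvagin fun W _ hW => h W hW

/-- **Net debt of the crux inside route ShadowIsolation, TangentCone form** (registered sub-goal
`selmerRankUB_of_isolation_of_shadow_of_edge`; every hypothesis is a registered item): the route's
own cruxes `IsolationOfAccidentalZeros`, `PhantomShadow` (the Ш-half, via
`shaCotorsionBigImage_of_isolation_of_shadow`) + TangentCone's `EdgeDecay`, `EdgeCap` (the rank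
half, via `noExcessRankBigImage_of_edgeDecay_of_edgeCap`) + `RankLeOne` (the GZK cell) give
`SelmerRankUB`. No `SqueezeUB`, no `SelmerRankShaPFinite`. [folklore] -/
theorem selmerRankUB_of_isolation_of_shadow_of_edge :
    Summit.BirchSwinnertonDyer.BirchSwinnertonDyer.Theses.ShadowIsolation.IsolationOfAccidentalZeros →
    Summit.BirchSwinnertonDyer.BirchSwinnertonDyer.Theses.ShadowIsolation.PhantomShadow →
    Summit.BirchSwinnertonDyer.BirchSwinnertonDyer.Theses.TangentCone.EdgeDecay →
    Summit.BirchSwinnertonDyer.BirchSwinnertonDyer.Theses.TangentCone.EdgeCap →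
    Summit.BirchSwinnertonDyer.BirchSwinnertonDyer.Theses.TangentCone.RankLeOne →
    Summit.BirchSwinnertonDyer.BirchSwinnertonDyer.Theses.ShadowIsolation.SelmerRankUB :=
  fun hIso hSh hE hC hR1 =>
    selmerRankUB_of_greenbergSplit (gzkSelmerCell_of_rankLeOne hR1)
      (noExcessRankBigImage_of_edgeDecay_of_edgeCap hE hC)
      (shaCotorsionBigImage_of_isolation_of_shadow hIso hSh)

/-- **Net debt of the crux inside route ShadowIsolation, `SqueezeUB` form** (registered sub-goal
`selmerRankUB_of_isolation_of_shadow_of_squeezeUB`; every hypothesis is a registered item): the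
route's own cruxes `IsolationOfAccidentalZeros`, `PhantomShadow` + the sibling crux `SqueezeUB`
(stmt-0496) + TangentCone's `RankLeOne` give `SelmerRankUB`. [folklore] -/
theorem selmerRankUB_of_isolation_of_shadow_of_squeezeUB :
    Summit.BirchSwinnertonDyer.BirchSwinnertonDyer.Theses.ShadowIsolation.IsolationOfAccidentalZeros →
    Summit.BirchSwinnertonDyer.BirchSwinnertonDyer.Theses.ShadowIsolation.PhantomShadow →
    Summit.BirchSwinnertonDyer.BirchSwinnertonDyer.Theses.Squeeze.SqueezeUB →
    Summit.BirchSwinnertonDyer.BirchSwinnertonDyer.Theses.TangentCone.RankLeOne →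
    Summit.BirchSwinnertonDyer.BirchSwinnertonDyer.Theses.ShadowIsolation.SelmerRankUB :=
  fun hIso hSh hSq hR1 =>
    selmerRankUB_of_greenbergSplit (gzkSelmerCell_of_rankLeOne hR1)
      (noExcessRankBigImage_of_squeezeUB hSq)
      (shaCotorsionBigImage_of_isolation_of_shadow hIso hSh)

/-- **Net debt of the crux inside route SelmerRank** (registered sub-goal
`selmerRankUBSelmerRank_of_shaPFinite_of_squeezeUB`; every hypothesis is a registered item): its
own crux `SelmerRankShaPFinite` (stmt-0132, the Ш-half via `shaCotorsionBigImage_of_shaPFinite`) +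
`SqueezeUB` + `RankLeOne` give the crux under route SelmerRank's decl name (which is `rfl`-equal to
ShadowIsolation's). [folklore] -/
theorem selmerRankUBSelmerRank_of_shaPFinite_of_squeezeUB :
    Summit.BirchSwinnertonDyer.BirchSwinnertonDyer.Theses.SelmerRank.SelmerRankShaPFinite →
    Summit.BirchSwinnertonDyer.BirchSwinnertonDyer.Theses.Squeeze.SqueezeUB →
    Summit.BirchSwinnertonDyer.BirchSwinnertonDyer.Theses.TangentCone.RankLeOne →
    Summit.BirchSwinnertonDyer.BirchSwinnertonDyer.Theses.SelmerRank.SelmerRankUB :=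
  fun hSha hSq hR1 W _ _ p _ h5 hgood hord hsurj =>
    selmerRankUB_of_greenbergSplit (gzkSelmerCell_of_rankLeOne hR1)
      (noExcessRankBigImage_of_squeezeUB hSq) (shaCotorsionBigImage_of_shaPFinite hSha)
      W p h5 hgood hord hsurj

end Summit.BirchSwinnertonDyer.BirchSwinnertonDyer.Theorems
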